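import Summits.ABC.ABC.Theses.DefiniteXi
import Literature.NumberTheory.EllipticCurves.DegreeConjectureAbcMurtyProofs
import Literature.NumberTheory.Automorphic.ShimuraCurveRibetTakahashiFreyManinProofs
import HarnessLib

/-!
# Stub-ideation k3, generation 14 (FAMILY 3 — PROBE THE EXTREMES) — `stub_primeToSixDegreeBound` (P6)
# crux `DefiniteXi.SteinbergCore` (stmt-ABC-15024), line `p6_tamagawa_split` (sha cda023e8)

Elaboration companion of `STUB-IDEAS-stub_primeToSixDegreeBound-3.md` (gen 14).  Gens 2–13 of this seat
stand by reference (`SketchStubIdeas3*.lean`, `STUB_IDEAS_stub_primeToSixDegreeBound_3_g10.lean`).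
Imports: the ROUTE FILE, the Literature modules `DegreeConjectureAbcMurtyProofs` /
`ShimuraCurveRibetTakahashiFreyManinProofs` only.  On 2026-08-31T23:45Z both the crux work-file
`STUB_IDEAS_stub_primeToSixDegreeBound_2_g10` and the landed Theorems module
`IneffectiveSubspaceUniformSadicTowerFourStubOmegaCountedTwo` (home of `omegaTwo_triple`) are
`remote:stale:116x:unbuilt` on the check farm, so `Stub`, `FreyPeterssonUpper`, H0 and Z1a are COPIED VERBATIM
from k2 g10 (credited) instead of imported, `omegaTwo_triple` is cited by name inside W2's docstring, and k1 g2's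
`freyPeterssonUpper_of_modularity : exists_isNewformOf → FreyPeterssonUpper` (PROVED there) is cited by name.

New Family-3 cell of gen 14 = the **height-tame strata** of Frey pairs `(a,b)`:

* `StubOn P` — the registered stub restricted to a stratum `P a b`; `Stub ↔ StubOn ⊤`,
  `StubOn P → StubOn ¬P → Stub` (case split, PROVED).
* **G (stratum transfer, PROVED modulo the two named inputs):** on ANY stratum where the naive height is
  `max(|a|,|b|) ≤ B_δ · N^{1+δ}` for every `δ > 0`, the stub holds — from k2 g10's Z1a
  `deg φ_D ≤ K_t c_D² N^{1+t} max(|a|,|b|)` (`StubIdeas2G10.deg_le_maninSq_mul_height`, PROVED from the Frey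
  Petersson upper bound, itself PROVED from modularity in k1 g2) evaluated at a datum `D₀` with `|c_{D₀}| ≤ M`
  (Pasten 2024 Cor. 10.2 for Frey curves: tree THEOREM
  `PastenShimura2024_cor_10_2.exists_freyCurve_datum_maninConstant_le`) and minimality `deg D ≤ deg D₀`.
* **T1 (sparse-support extreme = prime-times-2-power level):** `ω(|ab(a+b)|) ≤ 2` (⟺ `N = 2^f p^{≤1}`) ⟹
  `max(|a|,|b|) < 2·rad ≤ 4N` by the TREE theorem `UniformSadicTowerFour.MixedRadical.omegaTwo_triple`
  (Catalan–Mihăilescu corner of abc) + `radical_natAbs_dvd_two_mul_conductorNorm_freyCurve`; W2 below is its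
  `ℤ`-pair normalisation (PROVED here from W1 = that tree theorem taken as a hypothesis `OmegaTwoAbc`, because
  its module is unbuilt on the farm today; the sign trichotomy is one `omega` call).
* **T2 (multiplicity-free-top extreme):** top entry `m = max(|a|,|b|,|a+b|)` with `m ≤ B·rad(m)` ⟹
  `max(|a|,|b|) ≤ B·rad(ab(a+b)) ≤ 2B·N` (W3, PROVED).
* Residual open core = `{ω ≥ 3} ∩ {top powerful}` — contains every census record (Reyssat `2 + 3¹⁰109 = 23⁵`),
  and abc restricted to it is abc: the strata are abc's ELEMENTARY regime, not progress on the stub.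
-/

set_option linter.dupNamespace false

noncomputable section

namespace Summit.ABC.ABC.Cruxes.SteinbergCore.StubIdeas3G14

open scoped MatrixGroups
open Literature.NumberTheory.EllipticCurves Literature.NumberTheory.EllipticCurves.ModularForms
open Literature.NumberTheory.DiophantineGeometry Literature.NumberTheory.Automorphic
open CongruenceSubgroup UniqueFactorizationMonoid
open Summit.ABC.ABC.Theses.DefiniteXi

/-! ### Verbatim copies from k2 g10 (`StubIdeas2G10`, unbuilt on the farm today) -/

/-- The registered stub `stub_primeToSixDegreeBound` of `Lines/p6_tamagawa_split.lean`, verbatim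
(= `StubIdeas2G10.Stub` = `StubIdeas1G2.P6`). [folklore] -/
def Stub : Prop :=
  ∀ ε : ℝ, 0 < ε → ∃ C : ℝ, ∀ a b : ℤ, IsCoprime a b → a * b * (a + b) ≠ 0 → ∀ (N : ℕ) [NeZero N],
    (Literature.NumberTheory.EllipticCurves.freyCurve a b).conductorNorm ℤ = N →
    ∀ D : Literature.NumberTheory.EllipticCurves.ModularForms.ModularParametrizationData
      (Literature.NumberTheory.EllipticCurves.freyCurve a b) N,
      (∀ D' : Literature.NumberTheory.EllipticCurves.ModularForms.ModularParametrizationData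
        (Literature.NumberTheory.EllipticCurves.freyCurve a b) N, D.deg ≤ D'.deg) →
      ((D.deg / (ordProj[2] D.deg * ordProj[3] D.deg) : ℕ) : ℝ) ≤ C * (N : ℝ) ^ (2 + ε)

/-- **H0** (= tree `SteinbergCorePrimeRung.primeToSixDegreeBound_of_freyDegreeBound`, p162616; copy of
`StubIdeas2G10.stub_of_freyDegreeBound`): the route target gives the stub. [folklore] -/
theorem stub_of_freyDegreeBound (hX : FreyDegreeBound) : Stub := by
  intro ε hε
  obtain ⟨C, hC⟩ := hX ε hε
  refine ⟨C, fun a b hab h0 N _ hN D hDmin => ?_⟩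
  obtain ⟨D₀, hD₀⟩ := hC a b hab h0 N hN
  have h1 : ((D.deg / (ordProj[2] D.deg * ordProj[3] D.deg) : ℕ) : ℝ) ≤ (D.deg : ℝ) := by
    exact_mod_cast Nat.div_le_self _ _
  have h2 : (D.deg : ℝ) ≤ (D₀.deg : ℝ) := by exact_mod_cast hDmin D₀
  exact h1.trans (h2.trans hD₀)

/-- Petersson UPPER bound for the newform of every Frey curve — verbatim `StubIdeas1G2.FreyPeterssonUpper`
(PROVED there from modularity: `StubIdeas1G2.freyPeterssonUpper_of_modularity`). [folklore] -/
def FreyPeterssonUpper : Prop :=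
  ∀ t : ℝ, 0 < t → ∃ C₂ : ℝ, ∀ a b : ℤ, IsCoprime a b → a * b * (a + b) ≠ 0 →
    ∀ (N : ℕ) [NeZero N], (freyCurve a b).conductorNorm ℤ = N →
      ∀ f : CuspForm (Gamma0 N) 2, IsNewformOf (freyCurve a b) f →
        (peterssonProduct (Gamma0 N) 2 f f).re ≤ C₂ * (N : ℝ) ^ (1 + t)

/-- **Z1a** (verbatim `StubIdeas2G10.deg_le_maninSq_mul_height`, PROVED): `deg φ_D ≤ K_t c_D² N^{1+t} max(|a|,|b|)`
for EVERY datum `D` of every Frey curve. [cite: MurtyCongruencePrimes1999, §2] [cite: ZagierCMB1985, §1 (p. 374)] -/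
theorem deg_le_maninSq_mul_height (hUp : FreyPeterssonUpper) :
    ∀ t : ℝ, 0 < t → ∃ K : ℝ, 0 ≤ K ∧ ∀ a b : ℤ, IsCoprime a b → a * b * (a + b) ≠ 0 →
      ∀ (N : ℕ) [NeZero N], (freyCurve a b).conductorNorm ℤ = N →
        ∀ D : ModularParametrizationData (freyCurve a b) N,
          (D.deg : ℝ) ≤ K * (D.maninConstant : ℝ) ^ 2 * (N : ℝ) ^ (1 + t) * max |(a : ℝ)| |(b : ℝ)| := by
  intro t ht
  obtain ⟨C₂, hC₂⟩ := hUp t ht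
  obtain ⟨A, hA, hSil⟩ := covolume_rpow_neg_six_le_of_isNeronLatticeOf
  refine ⟨4 * Real.pi ^ 2 * max C₂ 0 * (331776 * A) ^ (1 / 6 : ℝ), by positivity,
    fun a b hab h0 N _ hN D => ?_⟩
  haveI := isElliptic_freyCurve h0
  have hNpos : (0 : ℝ) < N := by exact_mod_cast Nat.pos_of_ne_zero (NeZero.ne N)
  have hZ := congrArg Complex.re D.zagier_degree_formula_holds
  rw [Complex.re_ofReal_mul, Complex.ofReal_re] at hZ
  have hP0 : 0 ≤ (peterssonProduct (Gamma0 N) 2 D.f D.f).re :=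
    D.zagier_degree_formula_holds.peterssonProduct_re_pos.le
  have hcov : 0 < ZLattice.covolume D.L.lattice := ZLattice.covolume_pos _ _
  have hP : (peterssonProduct (Gamma0 N) 2 D.f D.f).re ≤ max C₂ 0 * (N : ℝ) ^ (1 + t) :=
    (hC₂ a b hab h0 N hN D.f D.isNewformOf).trans
      (mul_le_mul_of_nonneg_right (le_max_left _ _) (by positivity))
  set R : ℝ := max |(a : ℝ)| |(b : ℝ)| with hR
  have haR : |(a : ℝ)| ≤ R := le_max_left _ _
  have hbR : |(b : ℝ)| ≤ R := le_max_right _ _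
  have hR0 : 0 ≤ R := (abs_nonneg _).trans haR
  have h6 : ZLattice.covolume D.L.lattice ^ (-(6 : ℝ)) ≤ (331776 * A) * R ^ 6 := by
    calc ZLattice.covolume D.L.lattice ^ (-(6 : ℝ))
        ≤ A * ((max (|(freyCurve a b).c₄| ^ 3) (|(freyCurve a b).c₆| ^ 2) : ℚ) : ℝ) :=
          hSil (freyCurve a b) D.L D.isNeronLattice
      _ ≤ A * (331776 * R ^ 6) := mul_le_mul_of_nonneg_left (max_c₄_c₆_freyCurve_le haR hbR) hA.le
      _ = 331776 * A * R ^ 6 := by ring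
  have hinv := inv_le_of_rpow_neg_six_le hcov (by positivity) hR0 h6
  have hdeg := deg_le_of_zagier_of_upper hcov hZ le_rfl hP0 hP hinv
  have hsq : |(D.c : ℝ)| ^ 2 = (D.maninConstant : ℝ) ^ 2 := sq_abs _
  calc (D.deg : ℝ) ≤ 4 * Real.pi ^ 2 * |(D.c : ℝ)| ^ 2 * (max C₂ 0 * (N : ℝ) ^ (1 + t)) *
          ((331776 * A) ^ (1 / 6 : ℝ) * R) := hdeg
    _ = 4 * Real.pi ^ 2 * max C₂ 0 * (331776 * A) ^ (1 / 6 : ℝ) * (D.maninConstant : ℝ) ^ 2 *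
          (N : ℝ) ^ (1 + t) * R := by rw [← hsq]; ring

/-! ### Strata of the stub -/

/-- The registered stub `stub_primeToSixDegreeBound` RESTRICTED to the stratum `P a b` of Frey pairs.
[folklore] -/
def StubOn (P : ℤ → ℤ → Prop) : Prop :=
  ∀ ε : ℝ, 0 < ε → ∃ C : ℝ, ∀ a b : ℤ, IsCoprime a b → a * b * (a + b) ≠ 0 → P a b →
    ∀ (N : ℕ) [NeZero N], (freyCurve a b).conductorNorm ℤ = N →
    ∀ D : ModularParametrizationData (freyCurve a b) N,
      (∀ D' : ModularParametrizationData (freyCurve a b) N, D.deg ≤ D'.deg) →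
      ((D.deg / (ordProj[2] D.deg * ordProj[3] D.deg) : ℕ) : ℝ) ≤ C * (N : ℝ) ^ (2 + ε)

/-- `Stub ↔ StubOn ⊤`. [folklore] -/
theorem stub_iff_stubOn_univ : Stub ↔ StubOn fun _ _ => True := by
  constructor
  · intro h ε hε
    obtain ⟨C, hC⟩ := h ε hε
    exact ⟨C, fun a b hab h0 _ N _ hN D hD => hC a b hab h0 N hN D hD⟩
  · intro h ε hε
    obtain ⟨C, hC⟩ := h ε hε
    exact ⟨C, fun a b hab h0 N _ hN D hD => hC a b hab h0 trivial N hN D hD⟩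

/-- Monotonicity in the stratum. [folklore] -/
theorem stubOn_mono {P Q : ℤ → ℤ → Prop} (hPQ : ∀ a b, P a b → Q a b) (h : StubOn Q) : StubOn P := by
  intro ε hε
  obtain ⟨C, hC⟩ := h ε hε
  exact ⟨C, fun a b hab h0 hP N _ hN D hD => hC a b hab h0 (hPQ a b hP) N hN D hD⟩

/-- Case split: the stub on `P` and on `¬P` give the stub (`C = max C₁ C₂`). [folklore] -/
theorem stub_of_stubOn_split (P : ℤ → ℤ → Prop) (h₁ : StubOn P) (h₂ : StubOn fun a b => ¬ P a b) :
    Stub := by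
  intro ε hε
  obtain ⟨C₁, hC₁⟩ := h₁ ε hε
  obtain ⟨C₂, hC₂⟩ := h₂ ε hε
  refine ⟨max C₁ C₂, fun a b hab h0 N _ hN D hD => ?_⟩
  have hNε : (0 : ℝ) ≤ (N : ℝ) ^ (2 + ε) := Real.rpow_nonneg (Nat.cast_nonneg _) _
  by_cases hP : P a b
  · exact (hC₁ a b hab h0 hP N hN D hD).trans (mul_le_mul_of_nonneg_right (le_max_left _ _) hNε)
  · exact (hC₂ a b hab h0 hP N hN D hD).trans (mul_le_mul_of_nonneg_right (le_max_right _ _) hNε)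

/-! ### The Manin input (Pasten 2024, Cor. 10.2 — a tree THEOREM relative to named facts) -/

/-- Uniformly bounded Manin constants on the Frey family: SOME datum of every `E_(a,b)` has `|c| ≤ M`.
[cite: PastenShimura2024, Rem. 3.3 p. 13 and Cor. 10.2 p. 33] -/
def FreyManinBound : Prop :=
  ∃ M : ℕ, ∀ a b : ℤ, IsCoprime a b → a * b * (a + b) ≠ 0 →
    ∀ (N : ℕ) [NeZero N], (freyCurve a b).conductorNorm ℤ = N →
      ∃ D : ModularParametrizationData (freyCurve a b) N, D.maninConstant.natAbs ≤ M

/-- `FreyManinBound` from the named facts (term = the tree theorem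
`PastenShimura2024_cor_10_2.exists_freyCurve_datum_maninConstant_le`; `hNS` is DISCHARGED in the tree by
`integral_neronScaling_of_isGloballyMinimal_holds`, module `NeronIsogenyScalingHoldsProofs`, not imported
here to keep the closure light). [cite: PastenShimura2024, Cor. 10.2 p. 33] -/
theorem freyManinBound_of_facts (h102 : PastenShimura2024_cor_10_2)
    (hopt : exists_optimal_modularParametrizationData) (hMK : mazurKenku_exists_cyclic_isogeny)
    (hNS : integral_neronScaling_of_isGloballyMinimal) : FreyManinBound :=
  PastenShimura2024_cor_10_2.exists_freyCurve_datum_maninConstant_le h102 hopt hMK hNS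

/-! ### G — stratum transfer: height `≪ N^{1+δ}` on `P` ⟹ the stub on `P` -/

/-- **G (PROVED).** If on the stratum `P` the naive height satisfies `max(|a|,|b|) ≤ B_δ N^{1+δ}` for every
`δ > 0`, then the stub holds on `P`: `cps(deg D) ≤ deg D ≤ deg D₀ ≤ K c_{D₀}² N^{1+ε/2} H ≤ K M² B N^{2+ε}`,
with `D₀` the Manin-bounded datum and `D` the minimal one. [cite: MurtyCongruencePrimes1999, §2] -/
theorem stubOn_of_heightBound (hUp : FreyPeterssonUpper) (hM : FreyManinBound) {P : ℤ → ℤ → Prop}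
    (hP : ∀ δ : ℝ, 0 < δ → ∃ B : ℝ, ∀ a b : ℤ, IsCoprime a b → a * b * (a + b) ≠ 0 → P a b →
      ∀ (N : ℕ) [NeZero N], (freyCurve a b).conductorNorm ℤ = N →
        max |(a : ℝ)| |(b : ℝ)| ≤ B * (N : ℝ) ^ (1 + δ)) :
    StubOn P := by
  obtain ⟨M, hM⟩ := hM
  intro ε hε
  have hε2 : 0 < ε / 2 := half_pos hε
  obtain ⟨K, hK0, hK⟩ := deg_le_maninSq_mul_height hUp (ε / 2) hε2
  obtain ⟨B, hB⟩ := hP (ε / 2) hε2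
  refine ⟨K * (M : ℝ) ^ 2 * max B 0, fun a b hab h0 hPab N _ hN D hDmin => ?_⟩
  obtain ⟨D₀, hD₀⟩ := hM a b hab h0 N hN
  have hNpos : (0 : ℝ) < N := by exact_mod_cast Nat.pos_of_ne_zero (NeZero.ne N)
  have h1 : ((D.deg / (ordProj[2] D.deg * ordProj[3] D.deg) : ℕ) : ℝ) ≤ (D.deg : ℝ) := by
    exact_mod_cast Nat.div_le_self _ _
  have h2 : (D.deg : ℝ) ≤ (D₀.deg : ℝ) := by exact_mod_cast hDmin D₀
  have h3 := hK a b hab h0 N hN D₀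
  have hNt : (0 : ℝ) ≤ (N : ℝ) ^ (1 + ε / 2) := Real.rpow_nonneg hNpos.le _
  have hH0 : 0 ≤ max |(a : ℝ)| |(b : ℝ)| := (abs_nonneg _).trans (le_max_left _ _)
  have hH : max |(a : ℝ)| |(b : ℝ)| ≤ max B 0 * (N : ℝ) ^ (1 + ε / 2) :=
    (hB a b hab h0 hPab N hN).trans (mul_le_mul_of_nonneg_right (le_max_left _ _) hNt)
  have hcz : |D₀.maninConstant| ≤ ((M : ℕ) : ℤ) := by
    rw [Int.abs_eq_natAbs]; exact_mod_cast hD₀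
  have hcr : |(D₀.maninConstant : ℝ)| ≤ (M : ℝ) := by
    rw [← Int.cast_abs]; exact_mod_cast hcz
  have hc : (D₀.maninConstant : ℝ) ^ 2 ≤ (M : ℝ) ^ 2 :=
    sq_le_sq' (abs_le.mp hcr).1 (abs_le.mp hcr).2
  have hexp : (N : ℝ) ^ (1 + ε / 2) * (N : ℝ) ^ (1 + ε / 2) = (N : ℝ) ^ (2 + ε) := by
    rw [← Real.rpow_add hNpos]; congr 1; ring
  calc ((D.deg / (ordProj[2] D.deg * ordProj[3] D.deg) : ℕ) : ℝ) ≤ (D.deg : ℝ) := h1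
    _ ≤ (D₀.deg : ℝ) := h2
    _ ≤ K * (D₀.maninConstant : ℝ) ^ 2 * (N : ℝ) ^ (1 + ε / 2) * max |(a : ℝ)| |(b : ℝ)| := h3
    _ ≤ K * (M : ℝ) ^ 2 * (N : ℝ) ^ (1 + ε / 2) * (max B 0 * (N : ℝ) ^ (1 + ε / 2)) := by
        apply mul_le_mul _ hH hH0 (mul_nonneg (mul_nonneg hK0 (pow_nonneg (Nat.cast_nonneg M) 2)) hNt)
        exact mul_le_mul_of_nonneg_right (mul_le_mul_of_nonneg_left hc hK0) hNt
    _ = K * (M : ℝ) ^ 2 * max B 0 * (N : ℝ) ^ (2 + ε) := by rw [← hexp]; ring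

/-! ### T1 — the sparse-support extreme `ω(|ab(a+b)|) ≤ 2` (level `2^f · p^{≤1}`) -/

/-- The stratum `ω(|ab(a+b)|) ≤ 2`; since `2 ∣ ab(a+b)` always, this is `N_(a,b) = 2^f` or `2^f·p`.
[folklore] -/
def OmegaLeTwo (a b : ℤ) : Prop := ((a * b * (a + b)).natAbs).primeFactors.card ≤ 2

/-- **W1 = the TREE theorem `Summit.ABC.ABC.Theorems.UniformSadicTowerFour.MixedRadical.omegaTwo_triple`
as a statement** (abc with `C = 2`, exponent `1`, on the cell `ω(abc) ≤ 2`: Catalan–Mihăilescu + `2^m + 1 = 3^j`;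
PROVED in `Theorems/IneffectiveSubspaceUniformSadicTowerFourStubOmegaCountedTwo.lean`, whose module is
`remote:stale … unbuilt` on the farm today, hence a hypothesis here, discharged by that theorem BY NAME).
[folklore] -/
def OmegaTwoAbc : Prop :=
  ∀ {a b c : ℕ}, 0 < a → 0 < b → a + b = c → Nat.Coprime a b → (a * b * c).primeFactors.card ≤ 2 →
    c < 2 * rad a b c

/-- **W2 (PROVED from W1, size S): `ℤ`-pair normalisation** — for a coprime Frey pair on the stratum
`ω(|ab(a+b)|) ≤ 2`, `max(|a|,|b|) < 2·rad(ab(a+b))`: one of `|a|+|b| = |a+b|`, `|b|+|a+b| = |a|`,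
`|a|+|a+b| = |b|` holds (`omega`), and W1 applies to that ordered triple. [folklore] -/
theorem natAbs_lt_two_mul_radical_of_omegaLeTwo (hΩ : OmegaTwoAbc) {a b : ℤ} (hab : IsCoprime a b)
    (h0 : a * b * (a + b) ≠ 0) (hω : OmegaLeTwo a b) :
    max a.natAbs b.natAbs < 2 * radical (a * b * (a + b)).natAbs := by
  have ha : 0 < a.natAbs := Int.natAbs_pos.mpr fun h => h0 (by simp [h])
  have hb : 0 < b.natAbs := Int.natAbs_pos.mpr fun h => h0 (by simp [h])
  have hc : 0 < (a + b).natAbs := Int.natAbs_pos.mpr fun h => h0 (by simp [h])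
  have cop : ∀ {M N : ℤ}, IsCoprime M N → Nat.Coprime M.natAbs N.natAbs := by
    intro M N h
    rw [Nat.Coprime, ← Int.gcd_eq_natAbs]
    exact Int.isCoprime_iff_gcd_eq_one.mp h
  have hxy : Nat.Coprime a.natAbs b.natAbs := cop hab
  have hyz : Nat.Coprime b.natAbs (a + b).natAbs :=
    cop (by simpa [mul_one] using hab.symm.add_mul_left_right 1)
  have hxz : Nat.Coprime a.natAbs (a + b).natAbs :=
    cop (by simpa [mul_one, add_comm] using hab.add_mul_left_right 1)
  have habs : (a * b * (a + b)).natAbs = a.natAbs * b.natAbs * (a + b).natAbs := by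
    rw [Int.natAbs_mul, Int.natAbs_mul]
  unfold OmegaLeTwo at hω
  rw [habs] at hω ⊢
  rcases (by omega : a.natAbs + b.natAbs = (a + b).natAbs ∨ b.natAbs + (a + b).natAbs = a.natAbs ∨
      a.natAbs + (a + b).natAbs = b.natAbs) with h | h | h
  · have key := hΩ ha hb h hxy hω
    rw [rad_def] at key
    exact lt_of_le_of_lt (max_le (by omega) (by omega)) key
  · have key := hΩ hb hc h hyz
      (by rw [show b.natAbs * (a + b).natAbs * a.natAbs = a.natAbs * b.natAbs * (a + b).natAbs by ring]
          exact hω)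
    rw [rad_def, show b.natAbs * (a + b).natAbs * a.natAbs = a.natAbs * b.natAbs * (a + b).natAbs by
      ring] at key
    exact lt_of_le_of_lt (max_le le_rfl (by omega)) key
  · have key := hΩ ha hc h hxz
      (by rw [show a.natAbs * (a + b).natAbs * b.natAbs = a.natAbs * b.natAbs * (a + b).natAbs by ring]
          exact hω)
    rw [rad_def, show a.natAbs * (a + b).natAbs * b.natAbs = a.natAbs * b.natAbs * (a + b).natAbs by
      ring] at key
    exact lt_of_le_of_lt (max_le (by omega) le_rfl) key

/-- Sanity instance of W2's target inequality at the Catalan pair `(a,b) = (1,8)`: `1 + 8 = 9`,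
`|ab(a+b)| = 72 = 2³3²`, `rad = 6`, `max(1,8) = 8 < 12`. [folklore] -/
example : max (1 : ℤ).natAbs (8 : ℤ).natAbs < 2 * 6 := by decide

/-- **T1 (PROVED modulo the tree theorem W1): the stub holds on the stratum `ω ≤ 2`** — height
`< 2·rad ≤ 4N` (`radical_natAbs_dvd_two_mul_conductorNorm_freyCurve`), then G. [folklore] -/
theorem stubOn_omegaLeTwo (hΩ : OmegaTwoAbc) (hUp : FreyPeterssonUpper) (hM : FreyManinBound) :
    StubOn OmegaLeTwo := by
  apply stubOn_of_heightBound hUp hM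
  intro δ hδ
  refine ⟨4, fun a b hab h0 hω N _ hN => ?_⟩
  have hNpos : (0 : ℝ) < N := by exact_mod_cast Nat.pos_of_ne_zero (NeZero.ne N)
  have hlt := natAbs_lt_two_mul_radical_of_omegaLeTwo hΩ hab h0 hω
  have h1 : ((max a.natAbs b.natAbs : ℕ) : ℝ) ≤ 2 * ((radical (a * b * (a + b)).natAbs : ℕ) : ℝ) := by
    exact_mod_cast hlt.le
  have hrN : ((radical (a * b * (a + b)).natAbs : ℕ) : ℝ) ≤ 2 * N := by
    have hdvd := radical_natAbs_dvd_two_mul_conductorNorm_freyCurve hab h0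
    rw [hN] at hdvd
    exact_mod_cast Nat.le_of_dvd (Nat.pos_of_ne_zero (mul_ne_zero two_ne_zero (NeZero.ne N))) hdvd
  have hN1 : (N : ℝ) ≤ (N : ℝ) ^ (1 + δ) := by
    have h1N : (1 : ℝ) ≤ N := by exact_mod_cast Nat.one_le_iff_ne_zero.mpr (NeZero.ne N)
    simpa using Real.rpow_le_rpow_of_exponent_le h1N (show (1 : ℝ) ≤ 1 + δ by linarith)
  have hH : max |(a : ℝ)| |(b : ℝ)| = ((max a.natAbs b.natAbs : ℕ) : ℝ) := by
    rw [Nat.cast_max, Nat.cast_natAbs, Nat.cast_natAbs, Int.cast_abs, Int.cast_abs]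
  calc max |(a : ℝ)| |(b : ℝ)| = ((max a.natAbs b.natAbs : ℕ) : ℝ) := hH
    _ ≤ 2 * (2 * N) := h1.trans (mul_le_mul_of_nonneg_left hrN zero_le_two)
    _ = 4 * N := by ring
    _ ≤ 4 * (N : ℝ) ^ (1 + δ) := mul_le_mul_of_nonneg_left hN1 (by norm_num)

/-! ### T2 — the multiplicity-free-top extreme -/

/-- The top entry `max(|a|,|b|,|a+b|)` of the triple `(a, b, -(a+b))`. [folklore] -/
def topEntry (a b : ℤ) : ℕ := max (max a.natAbs b.natAbs) (a + b).natAbs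

/-- The stratum "powerful excess of the top entry at most `B`": `m ≤ B · rad(m)` for `m = topEntry a b`
(`B = 1` ⟺ square-free top). [folklore] -/
def TopTame (B : ℕ) (a b : ℤ) : Prop := topEntry a b ≤ B * radical (topEntry a b)

/-- **W3 (PROVED, XS):** on `TopTame B`, `max(|a|,|b|) ≤ topEntry ≤ B·rad(top) ≤ B·rad(ab(a+b))`
(`top ∣ ab(a+b)` ⟹ `rad(top) ∣ rad(ab(a+b))`, Mathlib `UniqueFactorizationMonoid.radical_dvd_radical`).
[folklore] -/
theorem natAbs_le_of_topTame {B : ℕ} {a b : ℤ} (h0 : a * b * (a + b) ≠ 0) (h : TopTame B a b) :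
    max a.natAbs b.natAbs ≤ B * radical (a * b * (a + b)).natAbs := by
  have hn0 : (a * b * (a + b)).natAbs ≠ 0 := Int.natAbs_ne_zero.mpr h0
  have habs : (a * b * (a + b)).natAbs = a.natAbs * b.natAbs * (a + b).natAbs := by
    rw [Int.natAbs_mul, Int.natAbs_mul]
  have hdvd : topEntry a b ∣ (a * b * (a + b)).natAbs := by
    rw [habs]
    unfold topEntry
    rcases le_total (max a.natAbs b.natAbs) (a + b).natAbs with h1 | h1
    · rw [max_eq_right h1]; exact ⟨a.natAbs * b.natAbs, by ring⟩
    · rw [max_eq_left h1]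
      rcases le_total a.natAbs b.natAbs with h2 | h2
      · rw [max_eq_right h2]; exact ⟨a.natAbs * (a + b).natAbs, by ring⟩
      · rw [max_eq_left h2]; exact ⟨b.natAbs * (a + b).natAbs, by ring⟩
  calc max a.natAbs b.natAbs ≤ topEntry a b := le_max_left _ _
    _ ≤ B * radical (topEntry a b) := h
    _ ≤ B * radical (a * b * (a + b)).natAbs :=
        Nat.mul_le_mul_left _ (Nat.le_of_dvd (Nat.radical_pos _) (radical_dvd_radical hdvd hn0))

/-- **T2 (PROVED): the stub holds on `TopTame B`** — height `≤ B·rad ≤ 2B·N`, then G.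
[folklore] -/
theorem stubOn_topTame (hUp : FreyPeterssonUpper) (hM : FreyManinBound) (B : ℕ) :
    StubOn (TopTame B) := by
  apply stubOn_of_heightBound hUp hM
  intro δ hδ
  refine ⟨2 * B, fun a b hab h0 hT N _ hN => ?_⟩
  have hNpos : (0 : ℝ) < N := by exact_mod_cast Nat.pos_of_ne_zero (NeZero.ne N)
  have hle := natAbs_le_of_topTame h0 hT
  have h1 : ((max a.natAbs b.natAbs : ℕ) : ℝ) ≤ B * ((radical (a * b * (a + b)).natAbs : ℕ) : ℝ) := by
    exact_mod_cast hle
  have hrN : ((radical (a * b * (a + b)).natAbs : ℕ) : ℝ) ≤ 2 * N := by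
    have hdvd := radical_natAbs_dvd_two_mul_conductorNorm_freyCurve hab h0
    rw [hN] at hdvd
    exact_mod_cast Nat.le_of_dvd (Nat.pos_of_ne_zero (mul_ne_zero two_ne_zero (NeZero.ne N))) hdvd
  have hN1 : (N : ℝ) ≤ (N : ℝ) ^ (1 + δ) := by
    have h1N : (1 : ℝ) ≤ N := by exact_mod_cast Nat.one_le_iff_ne_zero.mpr (NeZero.ne N)
    simpa using Real.rpow_le_rpow_of_exponent_le h1N (show (1 : ℝ) ≤ 1 + δ by linarith)
  have hH : max |(a : ℝ)| |(b : ℝ)| = ((max a.natAbs b.natAbs : ℕ) : ℝ) := by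
    rw [Nat.cast_max, Nat.cast_natAbs, Nat.cast_natAbs, Int.cast_abs, Int.cast_abs]
  calc max |(a : ℝ)| |(b : ℝ)| = ((max a.natAbs b.natAbs : ℕ) : ℝ) := hH
    _ ≤ B * (2 * N) := h1.trans (mul_le_mul_of_nonneg_left hrN (Nat.cast_nonneg _))
    _ = 2 * B * N := by ring
    _ ≤ 2 * B * (N : ℝ) ^ (1 + δ) := mul_le_mul_of_nonneg_left hN1 (by positivity)

/-! ### Assembly of the Family-3 picture -/

/-- **Dichotomy (PROVED; inputs W1 = tree theorem, FreyPeterssonUpper = k1 g2 theorem, FreyManinBound = Pasten).** The stub is equivalent to the stub on the RESIDUAL CORE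
`{ω(|ab(a+b)|) ≥ 3} ∩ {top entry not B-tame}` — the region of every census record-holder; abc restricted to it
is still abc, so this is a MAP of where the stub is elementary, not progress. [folklore] -/
theorem stub_of_stubOn_core (hΩ : OmegaTwoAbc) (hUp : FreyPeterssonUpper) (hM : FreyManinBound) (B : ℕ)
    (hcore : StubOn fun a b => ¬ (OmegaLeTwo a b ∨ TopTame B a b)) : Stub :=
  stub_of_stubOn_split _ (by
    -- `StubOn (OmegaLeTwo ∨ TopTame B)` from T1 and T2 with `C = max C₁ C₂`
    intro ε hε
    obtain ⟨C₁, hC₁⟩ := stubOn_omegaLeTwo hΩ hUp hM ε hε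
    obtain ⟨C₂, hC₂⟩ := stubOn_topTame hUp hM B ε hε
    refine ⟨max C₁ C₂, fun a b hab h0 hP N _ hN D hD => ?_⟩
    have hNε : (0 : ℝ) ≤ (N : ℝ) ^ (2 + ε) := Real.rpow_nonneg (Nat.cast_nonneg _) _
    rcases hP with hP | hP
    · exact (hC₁ a b hab h0 hP N hN D hD).trans (mul_le_mul_of_nonneg_right (le_max_left _ _) hNε)
    · exact (hC₂ a b hab h0 hP N hN D hD).trans (mul_le_mul_of_nonneg_right (le_max_right _ _) hNε))
    hcore

/-- **Plan A arrow H0 (tree, p162616; local copy above): the route target gives the stub.** [folklore] -/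
example (hX : FreyDegreeBound) : Stub := stub_of_freyDegreeBound hX

end Summit.ABC.ABC.Cruxes.SteinbergCore.StubIdeas3G14

end
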